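import Literature.AlgebraicGeometry.HodgeTheory.HardLefschetzHodgeRiemannHolds
import Literature.AlgebraicGeometry.HodgeTheory.CanonicalTrace
import Literature.AlgebraicGeometry.HodgeTheory.HodgeClassOfMorphismProofs
import Literature.AlgebraicGeometry.HodgeTheory.VanishingCohomologyNontrivialProofs
import Literature.AlgebraicGeometry.HodgeTheory.HodgeSectionRestrictionPairing
import Mathlib.LinearAlgebra.Matrix.NonsingularInverse
import HarnessLib

/-!
# Crux `HodgeProjectorAlgebraic` (stmt-HodgeConjecture-18705), line `birth` — stub 1 `stub_orthogonalHodgeProjector`: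
# the orthogonal projector of `H^{2n}(X(ℂ); ℂ)` onto the span of the rational `(n,n)`-classes exists

Route `HodgeConjecture/HodgeProjectorDivisorSupport`, crux W2 `HodgeProjectorAlgebraic`; registered skeleton
`Cruxes/HodgeProjectorAlgebraic/Lines/birth.lean` (`HodgeProjectorAlgebraic_of : Sig.stub_orthogonalHodgeProjector →
Sig.stub_gramKunnethClass → Sig.stub_gramClassAlgebraic → HodgeProjectorAlgebraic`). This file closes the registered stub

* **`stub_orthogonalHodgeProjector`** (signature VERBATIM; theorem-grade): for `X` smooth projective of dimension `2n ≥ 2`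
  there is a `ℂ`-linear endomorphism `P` of `H^{2n}(X(ℂ); ℂ)` with `P c = c` for every rational class `c` of Hodge type
  `(n,n)` and `P b = 0` for every class `b` cup-orthogonal to all rational `(n,n)`-classes.

Proof (Gram matrix; BFNP 2009 (6.1), Voisin I §7.1.2): let `s₁, …, s_m` be a `ℂ`-basis of `V = ℂ · Hdgⁿ(X)` consisting of
rational `(n,n)`-classes (`exists_linearIndependent`) and `G = (∫_X sᵢ ∪ sⱼ) ∈ M_m(ℚ)` its RATIONAL Gram matrix (rational
classes have rational traces, `traceC_ringChange`). `G` is injective on rational row vectors: if `q G = 0` then the rational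
`(n,n)`-class `c = Σ qᵢ sᵢ` satisfies `∫ c ∪ sⱼ = 0`, hence `c ∪ sⱼ = 0` (`∫_X` is injective on the top degree,
`eq_zero_of_traceC_eq_zero`), hence `c ∪ a = 0` for every rational `(n,n)`-class `a ∈ V`, so `c = 0` by the
NON-DEGENERACY OF THE CUP PAIRING ON HODGE CLASSES (the tree's theorem `hardLefschetz_hodgeRiemann_holds` through
`hodgeClasses_cupPairing_nondegenerate`: Hodge–Riemann) and `q = 0`. So `G ∈ GL_m(ℚ)` (`Matrix.vecMul_injective_iff_isUnit`),
its complexification `G_ℂ` is invertible, and `P = Σ_{k,j} (G_ℂ⁻¹)_{kj} (∫_X sⱼ ∪ ·) s_k` is the projector: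
`P sᵢ = Σ_k (G_ℂ⁻¹ G_ℂ)_{ki} s_k = sᵢ`, and `P b = 0` when every `sⱼ ∪ b = 0`.

No definition, no named fact, no sorry. References: [BrosnanFangNiePearlstein2009] §6 (6.1); [VoisinHodgeI2002] §7.1.2,
Thm. 6.32; [Kleiman1968] §1–2 (projectors from an invertible intersection matrix); [HatcherAT2002] §3.3 Thm. 3.26.
-/

noncomputable section

-- every declaration of this problem lives in `Summit.HodgeConjecture.HodgeConjecture.…` (summit = sub-problem)
set_option linter.dupNamespace false

open CategoryTheory AlgebraicGeometry
open Literature.AlgebraicGeometry.Motives Literature.AlgebraicGeometry.HodgeTheory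
open Literature.AlgebraicTopology.SingularHomology

namespace Summit.HodgeConjecture.HodgeConjecture.Theorems.HodgeProjectorAlgebraic

/-- **Stub `stub_orthogonalHodgeProjector` of crux `HodgeProjectorAlgebraic` (registered signature, verbatim):** for `X`
smooth projective of dimension `2n ≥ 2` there is a `ℂ`-linear `P` on `H^{2n}(X(ℂ); ℂ)` which is the identity on the
rational `(n,n)`-classes and zero on their cup-orthogonal — the Gram-matrix projector
`P = Σ_{k,j} (G_ℂ⁻¹)_{kj} (∫_X sⱼ ∪ ·) s_k` of a basis of rational `(n,n)`-classes, `G` invertible by the non-degeneracy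
of the cup pairing on Hodge classes (Hodge–Riemann). [cite: BrosnanFangNiePearlstein2009, §6 display (6.1)]
[cite: VoisinHodgeI2002, §7.1.2 and Thm. 6.32] [cite: Kleiman1968, §2] -/
theorem stub_orthogonalHodgeProjector :
    ∀ (n : ℕ) (X : SchemeOver ℂ) (hX : IsSmoothProjective (2 * n) X), 1 ≤ n →
      ∃ P : complexBetti X (2 * n) →ₗ[ℂ] complexBetti X (2 * n),
        (∀ c : complexBetti X (2 * n), IsRationalClass c → IsOfHodgeType (2 * n) X (2 * n) n n c →
          P c = c) ∧
        (∀ b : complexBetti X (2 * n),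
          (∀ a : complexBetti X (2 * n), IsRationalClass a → IsOfHodgeType (2 * n) X (2 * n) n n a →
            cupProduct (rfl : 2 * n + 2 * n = 2 * n + 2 * n) a b = 0) →
          P b = 0) := by
  intro n X hX _hn
  classical
  obtain ⟨A⟩ := nonempty_hodgeModel_holds (n := 2 * n) (X := X) hX
  haveI : Module.Finite ℂ (complexBetti X (2 * n)) := finite_complexBetti hX (2 * n)
  have h4 : 2 * n + 2 * n = 2 * (2 * n) := by ring
  -- the rational `(n,n)`-classes and a `ℂ`-basis of their span taken among them
  set S : Set (complexBetti X (2 * n)) :=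
    {c | IsRationalClass c ∧ IsOfHodgeType (2 * n) X (2 * n) n n c} with hS
  obtain ⟨b, hbS, hbspan, hbli⟩ := exists_linearIndependent ℂ S
  have hbfin : b.Finite := hbli.setFinite
  haveI : Fintype b := hbfin.fintype
  have hsQ : ∀ i : b, IsRationalClass (i : complexBetti X (2 * n)) := fun i ↦ (hbS i.2).1
  have hsT : ∀ i : b, IsOfHodgeType (2 * n) X (2 * n) n n (i : complexBetti X (2 * n)) :=
    fun i ↦ (hbS i.2).2
  have hmemS : ∀ a ∈ S, a ∈ Submodule.span ℂ b := fun a ha ↦ hbspan ▸ Submodule.subset_span ha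
  -- the rational Gram matrix `G = (∫ sᵢ ∪ sⱼ)` and its complexification
  have hrat : ∀ i j : b, ∃ a : singularCohomology ℚ ℚ (ComplexPoints X) (2 * (2 * n)),
      singularCohomology.ringChange (algebraMap ℚ ℂ) (ComplexPoints X) (2 * (2 * n)) a =
        cupProduct h4 (i : complexBetti X (2 * n)) (j : complexBetti X (2 * n)) :=
    fun i j ↦ ((hsQ i).cup h4 (hsQ j)).exists_ringChange_eq
  choose r hr using hrat
  let G : Matrix b b ℚ := Matrix.of fun i j ↦ trace hX (r i j)
  let GC : Matrix b b ℂ := G.map (algebraMap ℚ ℂ)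
  have hGC : ∀ i j : b,
      GC i j = traceC hX (cupProduct h4 (i : complexBetti X (2 * n)) (j : complexBetti X (2 * n))) := by
    intro i j
    simp only [GC, G, Matrix.map_apply, Matrix.of_apply]
    rw [← traceC_ringChange, hr]
  -- `G` is injective on rational row vectors: non-degeneracy of the cup pairing on Hodge classes
  have hker : ∀ q : b → ℚ, Matrix.vecMul q G = 0 → q = 0 := by
    intro q hq
    set c : complexBetti X (2 * n) := ∑ i, ((q i : ℚ) : ℂ) • (i : complexBetti X (2 * n)) with hc
    have hcQ : IsRationalClass c := isRationalClass_sum _ _ fun i _ ↦ (hsQ i).smul (q i)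
    have hcT : IsOfHodgeType (2 * n) X (2 * n) n n c :=
      IsOfHodgeType.sum hX A _ _ fun i _ ↦ (hsT i).smul _
    -- `c ∪ sⱼ = 0` for all `j`
    have hcs : ∀ j : b, cupProduct h4 c (j : complexBetti X (2 * n)) = 0 := by
      intro j
      apply eq_zero_of_traceC_eq_zero hX
      have hqj : (algebraMap ℚ ℂ) (Matrix.vecMul q G j) = 0 := by rw [hq, Pi.zero_apply, map_zero]
      rw [Matrix.vecMul, dotProduct, map_sum] at hqj
      simp only [map_mul] at hqj
      have hsum : traceC hX (cupProduct h4 c (j : complexBetti X (2 * n))) =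
          ∑ i, ((q i : ℚ) : ℂ) *
            traceC hX (cupProduct h4 (i : complexBetti X (2 * n)) (j : complexBetti X (2 * n))) := by
        rw [hc, map_sum, LinearMap.sum_apply, map_sum]
        refine Finset.sum_congr rfl fun i _ ↦ ?_
        rw [map_smul, LinearMap.smul_apply, map_smul, smul_eq_mul]
      rw [hsum, ← hqj]
      refine Finset.sum_congr rfl fun i _ ↦ ?_
      rw [← hGC i j]
      simp [GC, Matrix.map_apply]
    -- hence `c ∪ a = 0` for every rational `(n,n)`-class `a`
    have hca : ∀ a ∈ S, cupProduct h4 c a = 0 := by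
      intro a ha
      refine Submodule.span_induction (p := fun a _ ↦ cupProduct h4 c a = 0) ?_ ?_ ?_ ?_ (hmemS a ha)
      · intro x hx
        exact hcs ⟨x, hx⟩
      · exact map_zero _
      · intro x y _ _ hx hy
        rw [map_add, hx, hy, add_zero]
      · intro t x _ hx
        rw [map_smul, hx, smul_zero]
    -- non-degeneracy (Hodge–Riemann): `c = 0`
    have hc0 : c = 0 := by
      by_contra hne
      obtain ⟨a, haQ, haT, hne'⟩ :=
        hardLefschetz_hodgeRiemann_holds.hodgeClasses_cupPairing_nondegenerate hX (2 * (2 * n))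
          (by omega : n + n = 2 * n) h4 c hcQ hcT hne
      exact hne' (hca a ⟨haQ, haT⟩)
    -- independence of the basis: `q = 0`
    have hq0 := Fintype.linearIndependent_iff.1 hbli (fun i ↦ ((q i : ℚ) : ℂ)) (by rw [← hc]; exact hc0)
    funext i
    exact_mod_cast hq0 i
  have hGinj : Function.Injective G.vecMul := by
    intro q q' hqq'
    have hqq : Matrix.vecMul q G = Matrix.vecMul q' G := hqq'
    rw [← sub_eq_zero]
    refine hker _ ?_
    rw [Matrix.sub_vecMul, hqq, sub_self]
  have hGCu : IsUnit GC := by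
    have h := (Matrix.vecMul_injective_iff_isUnit.1 hGinj).map (algebraMap ℚ ℂ).mapMatrix
    rwa [RingHom.mapMatrix_apply] at h
  have hdet : IsUnit GC.det := (Matrix.isUnit_iff_isUnit_det _).1 hGCu
  -- the projector
  let φ : b → (complexBetti X (2 * n) →ₗ[ℂ] ℂ) :=
    fun j ↦ traceC hX ∘ₗ cupProduct h4 (j : complexBetti X (2 * n))
  let P : complexBetti X (2 * n) →ₗ[ℂ] complexBetti X (2 * n) :=
    ∑ k : b, ∑ j : b, GC⁻¹ k j • (φ j).smulRight (k : complexBetti X (2 * n))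
  have hPapply : ∀ x, P x = ∑ k : b, ∑ j : b,
      (GC⁻¹ k j * traceC hX (cupProduct h4 (j : complexBetti X (2 * n)) x)) •
        (k : complexBetti X (2 * n)) := by
    intro x
    simp only [P, φ, LinearMap.sum_apply, LinearMap.smul_apply, LinearMap.smulRight_apply,
      LinearMap.comp_apply, smul_smul]
  refine ⟨P, ?_, ?_⟩
  · -- `P = id` on `V = span b ⊇ S`
    intro c hcQ hcT
    have hbasis : ∀ i : b, P (i : complexBetti X (2 * n)) = i := by
      intro i
      rw [hPapply]
      simp_rw [← hGC, ← Finset.sum_smul, ← Matrix.mul_apply, Matrix.nonsing_inv_mul _ hdet,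
        Matrix.one_apply, ite_smul, one_smul, zero_smul]
      rw [Finset.sum_ite_eq' Finset.univ i]
      simp
    refine Submodule.span_induction (p := fun a _ ↦ P a = a) ?_ ?_ ?_ ?_ (hmemS c ⟨hcQ, hcT⟩)
    · intro x hx
      exact hbasis ⟨x, hx⟩
    · exact map_zero _
    · intro x y _ _ hx hy
      rw [map_add, hx, hy]
    · intro t x _ hx
      rw [map_smul, hx]
  · -- `P = 0` on the cup-orthogonal of the rational `(n,n)`-classes
    intro x hx
    rw [hPapply]
    refine Finset.sum_eq_zero fun k _ ↦ Finset.sum_eq_zero fun j _ ↦ ?_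
    have h0 : cupProduct h4 (j : complexBetti X (2 * n)) x = 0 :=
      (cupProduct_eq_zero_iff_of_degree_eq rfl h4 _ x).1 (hx j (hsQ j) (hsT j))
    rw [h0, map_zero, mul_zero, zero_smul]

end Summit.HodgeConjecture.HodgeConjecture.Theorems.HodgeProjectorAlgebraic

end
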